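import Summits.KontsevichZagierPeriods.KontsevichZagierPeriods.Theorems.GpcLegendreLemniscatic.Negative.Canonical
import Literature.NumberTheory.Transcendental.KZLogCalculusProofs
import Literature.NumberTheory.Transcendental.KZSemialgebraicComplex

/-!
# `LegendreAllModuli` (stmt-KontsevichZagierPeriods-3523), line `Sketch` — stub M1 `stub_symmetrise`

Swap symmetrisation inside the Kontsevich–Zagier move calculus. Write `m = k²`,
`κ_m(t) = 1/√((1−t²)(1−mt²))` (`ellIntegrand m`), `e_m(t) = √(1−mt²)/√(1−t²)`.
On `(0,1)²` the crux integrand is `f_k = e_m ⊗ κ_{1−m} + e_{1−m} ⊗ κ_m − κ_m ⊗ κ_{1−m}` and the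
one-representation Legendre integrand is `F_m = κ_m ⊗ e_{1−m} + e_m ⊗ κ_{1−m} − κ_m ⊗ κ_{1−m}`, so
`f_k − F_m = h − h ∘ swap` with `h = e_{1−m} ⊗ κ_m`. The proof uses two integrand additivities
(rule 1b) around ONE coordinate swap (rule 2, `KZ.of_sub_of_reindex_mem_relations`):

* `P₂ = [e_m]·[κ_{1−m}]`, `P₃ = [κ_m]·[κ_{1−m}]`, `P₄ = [e_{1−m}]·[κ_m]` (Fubini products of
  unit-interval representations `unitRep`, all with domain `(0,1)²`), `P₁ = P₄.reindex swap`,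
* `A = [(0,1)², P₂.integrand − P₃.integrand]`, `q = [(0,1)², A.integrand + P₁.integrand]`;

then `[r] − [q] = ([r] − [A] − [P₄]) − ([q] − [A] − [P₁]) + ([P₄] − [P₁]) ∈ relations`.
All auxiliary representations are produced by existence lemmas (no new definitions).
[cite: KontsevichZagier2001, §1.2 rules (1)–(2)]
-/

noncomputable section

open MeasureTheory Set
open Literature.NumberTheory.Transcendental
open Literature.NumberTheory.Transcendental.KZ
open Literature.Probability.RandomPlanarGeometry (ellIntegrand intervalIntegrable_ellIntegrand)
open MvPolynomial (aeval X)
open Summit.KontsevichZagierPeriods.Grothendieck.GpcLegendreLemniscaticNegative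

namespace Summit.KontsevichZagierPeriods.UnfoldedStokes.LegendreAllModuliLine

namespace M1

/-! ## One-dimensional densities `κ_m`, `e_m` on `(0,1)` -/

variable {m : ℝ}

/-- On `(0,1)`, `1 − t² > 0`. [folklore] -/
theorem one_sub_sq_pos {t : ℝ} (ht : t ∈ Ioo (0:ℝ) 1) : 0 < 1 - t ^ 2 := by
  nlinarith [ht.1, ht.2]

/-- On `(0,1)`, `1 − m t² > 0` whenever `m < 1`. [folklore] -/
theorem lin_pos (hm1 : m < 1) {t : ℝ} (ht : t ∈ Ioo (0:ℝ) 1) : 0 < 1 - m * t ^ 2 := by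
  have h1 : 0 < 1 - t ^ 2 := one_sub_sq_pos ht
  nlinarith [mul_nonneg (sub_pos.2 hm1).le (sq_nonneg t)]

/-- `x ↦ 1 − m x₀²` is `ℚ`-semialgebraic on `unitIoo` for real-algebraic `m`. [folklore] -/
theorem isSemialgebraicFunOn_lin (hm : IsAlgebraic ℚ m) :
    IsSemialgebraicFunOn ℚ unitIoo (fun x => 1 - m * x 0 ^ 2) := by
  have hc := isSemialgebraicFunOn_const_of_isAlgebraic isSemialgebraic_unitIoo hm
  have hsq := isSemialgebraicFunOn_aeval isSemialgebraic_unitIoo (X 0 ^ 2 : MvPolynomial (Fin 1) ℚ)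
  have h1 := isSemialgebraicFunOn_ratCast isSemialgebraic_unitIoo 1
  have h := IsSemialgebraicFunOn.sub_holds h1 (IsSemialgebraicFunOn.mul_holds hc hsq)
  refine h.congr fun x _ => ?_
  simp

/-- `x ↦ κ_m(x₀)` is `ℚ`-semialgebraic on `unitIoo` (`m` real-algebraic, `m < 1`). [folklore] -/
theorem isSemialgebraicFunOn_kap (hm : IsAlgebraic ℚ m) (hm1 : m < 1) :
    IsSemialgebraicFunOn ℚ unitIoo (fun x => ellIntegrand m (x 0)) := by
  have hp := IsSemialgebraicFunOn.mul_holds isSemialgebraicFunOn_one_sub_sq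
    (isSemialgebraicFunOn_lin hm)
  have hsqrt := IsSemialgebraicFunOn.sqrt_holds hp
  have h1 := isSemialgebraicFunOn_ratCast isSemialgebraic_unitIoo 1
  refine ((h1.div hsqrt) fun x hx => ?_).congr fun x _ => ?_
  · exact (Real.sqrt_pos.2 (mul_pos (one_sub_sq_pos hx) (lin_pos hm1 hx))).ne'
  · simp [ellIntegrand]

/-- `x ↦ e_m(x₀) = √(1 − m x₀²)/√(1 − x₀²)` is `ℚ`-semialgebraic on `unitIoo` (`m` real-algebraic).
[folklore] -/
theorem isSemialgebraicFunOn_e (hm : IsAlgebraic ℚ m) :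
    IsSemialgebraicFunOn ℚ unitIoo
      (fun x => Real.sqrt (1 - m * x 0 ^ 2) / Real.sqrt (1 - x 0 ^ 2)) := by
  have hn := IsSemialgebraicFunOn.sqrt_holds (isSemialgebraicFunOn_lin hm)
  have hd := IsSemialgebraicFunOn.sqrt_holds isSemialgebraicFunOn_one_sub_sq
  exact (hn.div hd) fun x hx => (Real.sqrt_pos.2 (one_sub_sq_pos hx)).ne'

/-- `κ_m` is integrable on `(0,1)` for `0 ≤ m < 1`. [folklore] -/
theorem integrableOn_kap (hm0 : 0 ≤ m) (hm1 : m < 1) : IntegrableOn (ellIntegrand m) (Ioo 0 1) := by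
  have h := intervalIntegrable_ellIntegrand hm0 hm1
  rwa [intervalIntegrable_iff_integrableOn_Ioo_of_le zero_le_one] at h

/-- `e_m ≤ κ_0` on `(0,1)` for `0 ≤ m`, so `e_m` is integrable on `(0,1)`. [folklore] -/
theorem integrableOn_e (hm0 : 0 ≤ m) :
    IntegrableOn (fun t => Real.sqrt (1 - m * t ^ 2) / Real.sqrt (1 - t ^ 2)) (Ioo 0 1) := by
  have h := intervalIntegrable_ellIntegrand (m := 0) le_rfl (by norm_num)
  rw [intervalIntegrable_iff_integrableOn_Ioo_of_le zero_le_one] at h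
  refine h.mono' ?_ ?_
  · refine ContinuousOn.aestronglyMeasurable ?_ measurableSet_Ioo
    refine ContinuousOn.div (by fun_prop) (by fun_prop) fun t ht => ?_
    exact (Real.sqrt_pos.2 (one_sub_sq_pos ht)).ne'
  · refine (ae_restrict_mem measurableSet_Ioo).mono fun t ht => ?_
    have hs : 0 < Real.sqrt (1 - t ^ 2) := Real.sqrt_pos.2 (one_sub_sq_pos ht)
    have hnum : Real.sqrt (1 - m * t ^ 2) ≤ 1 := by
      rw [Real.sqrt_le_one]
      linarith [mul_nonneg hm0 (sq_nonneg t)]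
    rw [Real.norm_eq_abs, abs_of_nonneg (div_nonneg (Real.sqrt_nonneg _) hs.le),
      ellIntegrand, zero_mul, sub_zero, mul_one]
    exact div_le_div_of_nonneg_right hnum hs.le

/-! ## Two-dimensional representations: products, swap, difference, sum -/

/-- **Fubini product of two unit-interval representations**: a representation with domain
`(0,1)²` and integrand `h₁(x₀)·h₂(x₁)` (`unitRep`, `IntegralRep.prod`, `prod_integrand_eq`).
[cite: KontsevichZagier2001, §4.1] -/
theorem exists_prod (h₁ h₂ : ℝ → ℝ) (hh₁ : IsSemialgebraicFunOn ℚ unitIoo (fun x => h₁ (x 0)))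
    (hi₁ : IntegrableOn h₁ (Ioo 0 1)) (hh₂ : IsSemialgebraicFunOn ℚ unitIoo (fun x => h₂ (x 0)))
    (hi₂ : IntegrableOn h₂ (Ioo 0 1)) :
    ∃ P : IntegralRep 2, P.domain = unitSq ∧ P.integrand = fun x => h₁ (x 0) * h₂ (x 1) := by
  refine ⟨(unitRep h₁ hh₁ hi₁).prod (unitRep h₂ hh₂ hi₂), ?_, ?_⟩
  · ext x
    change x 0 ∈ Ioo (0:ℝ) 1 ∧ x 1 ∈ Ioo (0:ℝ) 1 ↔ x ∈ unitSq
    simp [unitSq, Fin.forall_fin_two]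
  · rw [IntegralRep.prod_integrand_eq]
    rfl

/-- `[e_a]·[κ_b] = [(0,1)², e_a ⊗ κ_b]` for real-algebraic `a ≥ 0` and `b ∈ [0,1)`. [folklore] -/
theorem exists_eKapRep {a b : ℝ} (ha : IsAlgebraic ℚ a) (ha0 : 0 ≤ a) (hb : IsAlgebraic ℚ b)
    (hb0 : 0 ≤ b) (hb1 : b < 1) :
    ∃ P : IntegralRep 2, P.domain = unitSq ∧
      P.integrand = fun x => Real.sqrt (1 - a * x 0 ^ 2) / Real.sqrt (1 - x 0 ^ 2) *
        ellIntegrand b (x 1) :=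
  exists_prod (fun t => Real.sqrt (1 - a * t ^ 2) / Real.sqrt (1 - t ^ 2)) (ellIntegrand b)
    (isSemialgebraicFunOn_e ha) (integrableOn_e ha0) (isSemialgebraicFunOn_kap hb hb1)
    (integrableOn_kap hb0 hb1)

/-- `[κ_a]·[κ_b] = [(0,1)², κ_a ⊗ κ_b]` for real-algebraic `a, b ∈ [0,1)`. [folklore] -/
theorem exists_kapKapRep {a b : ℝ} (ha : IsAlgebraic ℚ a) (ha0 : 0 ≤ a) (ha1 : a < 1)
    (hb : IsAlgebraic ℚ b) (hb0 : 0 ≤ b) (hb1 : b < 1) :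
    ∃ P : IntegralRep 2, P.domain = unitSq ∧
      P.integrand = fun x => ellIntegrand a (x 0) * ellIntegrand b (x 1) :=
  exists_prod (ellIntegrand a) (ellIntegrand b) (isSemialgebraicFunOn_kap ha ha1)
    (integrableOn_kap ha0 ha1) (isSemialgebraicFunOn_kap hb hb1) (integrableOn_kap hb0 hb1)

/-- **The coordinate swap is a move**: for a representation `P` on `(0,1)²`, the reindexed
representation `P.reindex swap` has domain `(0,1)²`, integrand `P.integrand ∘ swap`, and
`[P] − [P.reindex swap] ∈ relations` (`KZ.of_sub_of_reindex_mem_relations`, rule 2).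
[cite: KontsevichZagier2001, §1.2 rules (1)–(2)] -/
theorem exists_swap (P : IntegralRep 2) (hP : P.domain = unitSq) :
    ∃ P' : IntegralRep 2, P'.domain = unitSq ∧
      (P'.integrand = fun w => P.integrand fun i => w (Equiv.swap (0 : Fin 2) 1 i)) ∧
      of P - of P' ∈ relations := by
  refine ⟨P.reindex (Equiv.swap (0 : Fin 2) 1), ?_, rfl, of_sub_of_reindex_mem_relations _ _⟩
  ext w
  rw [IntegralRep.reindex_domain, mem_setOf_eq, hP]
  simp only [Equiv.swap_apply_left, Equiv.swap_apply_right, unitSq, Fin.forall_fin_two,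
    mem_setOf_eq]
  exact and_comm

/-- The difference representation `[σ, f − g]` of two representations on the same domain
(semialgebraic by `IsSemialgebraicFunOn.sub_holds`, integrable by `IntegrableOn.sub`).
[folklore] -/
theorem exists_sub {n : ℕ} (P Q : IntegralRep n) (hQ : Q.domain = P.domain) :
    ∃ A : IntegralRep n, A.domain = P.domain ∧ A.integrand = P.integrand - Q.integrand := by
  have hQs : IsSemialgebraicFunOn ℚ P.domain Q.integrand := hQ ▸ Q.isSemialgebraicFunOn_integrand
  have hQi : IntegrableOn Q.integrand P.domain := hQ ▸ Q.integrableOn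
  exact ⟨⟨P.domain, P.integrand - Q.integrand, P.isSemialgebraic_domain,
    IsSemialgebraicFunOn.sub_holds P.isSemialgebraicFunOn_integrand hQs, P.integrableOn.sub hQi⟩,
    rfl, rfl⟩

/-- The sum representation `[σ, f + g]` of two representations on the same domain
(semialgebraic by `IsSemialgebraicFunOn.add_holds`, integrable by `IntegrableOn.add`).
[folklore] -/
theorem exists_add {n : ℕ} (P Q : IntegralRep n) (hQ : Q.domain = P.domain) :
    ∃ S : IntegralRep n, S.domain = P.domain ∧ S.integrand = P.integrand + Q.integrand := by
  have hQs : IsSemialgebraicFunOn ℚ P.domain Q.integrand := hQ ▸ Q.isSemialgebraicFunOn_integrand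
  have hQi : IntegrableOn Q.integrand P.domain := hQ ▸ Q.integrableOn
  exact ⟨⟨P.domain, P.integrand + Q.integrand, P.isSemialgebraic_domain,
    IsSemialgebraicFunOn.add_holds P.isSemialgebraicFunOn_integrand hQs, P.integrableOn.add hQi⟩,
    rfl, rfl⟩

end M1

open M1 in
/-- **M1, swap symmetrisation**: for real algebraic `k ∈ (0,1)` the crux representation
`[(0,1)², e_k ⊗ κ_{k′} + e_{k′} ⊗ κ_k − κ_k ⊗ κ_{k′}]` is equivalent to the one-representation
Legendre representation `[(0,1)², F_{k²}]`, `F_m = κ_m ⊗ e_{1−m} + e_m ⊗ κ_{1−m} − κ_m ⊗ κ_{1−m}`: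
the two integrands differ by `h − h ∘ swap`, `h = e_{k′} ⊗ κ_k`, and `[□, h] − [□, h ∘ swap]` is the
coordinate swap (rule 2); two integrand additivities (rule 1b).
[cite: KontsevichZagier2001, §1.2 rules (1)–(2)] -/
theorem stub_symmetrise :
    ∀ k : ℝ, IsAlgebraic ℚ k → 0 < k → k < 1 →
      ∀ r : IntegralRep 2, r.domain = unitSq →
        EqOn r.integrand (fun x => Real.sqrt (1 - k ^ 2 * x 0 ^ 2) / Real.sqrt (1 - x 0 ^ 2) /
              Real.sqrt ((1 - x 1 ^ 2) * (1 - (1 - k ^ 2) * x 1 ^ 2)) +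
            Real.sqrt (1 - (1 - k ^ 2) * x 0 ^ 2) / Real.sqrt (1 - x 0 ^ 2) /
              Real.sqrt ((1 - x 1 ^ 2) * (1 - k ^ 2 * x 1 ^ 2)) -
            1 / Real.sqrt ((1 - x 0 ^ 2) * (1 - k ^ 2 * x 0 ^ 2)) /
              Real.sqrt ((1 - x 1 ^ 2) * (1 - (1 - k ^ 2) * x 1 ^ 2))) unitSq →
        ∃ q : IntegralRep 2, q.domain = unitSq ∧
          EqOn q.integrand (fun x => 1 / Real.sqrt ((1 - x 0 ^ 2) * (1 - k ^ 2 * x 0 ^ 2)) *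
                (Real.sqrt (1 - (1 - k ^ 2) * x 1 ^ 2) / Real.sqrt (1 - x 1 ^ 2)) +
              Real.sqrt (1 - k ^ 2 * x 0 ^ 2) / Real.sqrt (1 - x 0 ^ 2) *
                (1 / Real.sqrt ((1 - x 1 ^ 2) * (1 - (1 - k ^ 2) * x 1 ^ 2))) -
              1 / Real.sqrt ((1 - x 0 ^ 2) * (1 - k ^ 2 * x 0 ^ 2)) *
                (1 / Real.sqrt ((1 - x 1 ^ 2) * (1 - (1 - k ^ 2) * x 1 ^ 2)))) unitSq ∧
          Equivalent r q := by
  intro k hk hk0 hk1 r hrd hri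
  -- the parameters `m = k²`, `1 − m = k′²`
  have hm : IsAlgebraic ℚ (k ^ 2) := hk.pow 2
  have hm' : IsAlgebraic ℚ (1 - k ^ 2) := isAlgebraic_one.sub hm
  have hm0 : 0 ≤ k ^ 2 := sq_nonneg k
  have hm1 : k ^ 2 < 1 := by nlinarith
  have hm'0 : 0 ≤ 1 - k ^ 2 := by nlinarith
  have hm'1 : 1 - k ^ 2 < 1 := by nlinarith
  -- `P₂ = [e_m]·[κ_{1−m}]`, `P₃ = [κ_m]·[κ_{1−m}]`, `P₄ = [e_{1−m}]·[κ_m]`, `P₁ = P₄ ∘ swap`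
  obtain ⟨P2, hP2d, hP2i⟩ := exists_eKapRep hm hm0 hm' hm'0 hm'1
  obtain ⟨P3, hP3d, hP3i⟩ := exists_kapKapRep hm hm0 hm1 hm' hm'0 hm'1
  obtain ⟨P4, hP4d, hP4i⟩ := exists_eKapRep hm' hm'0 hm hm0 hm1
  obtain ⟨P1, hP1d, hP1i, R3⟩ := exists_swap P4 hP4d
  -- `A = [(0,1)², P₂ − P₃]`, `q = [(0,1)², A + P₁]`
  obtain ⟨A, hAd, hAi⟩ := exists_sub P2 P3 (hP3d.trans hP2d.symm)
  have hAd' : A.domain = unitSq := hAd.trans hP2d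
  obtain ⟨q, hqd, hqi⟩ := exists_add A P1 (hP1d.trans hAd'.symm)
  have hqd' : q.domain = unitSq := hqd.trans hAd'
  refine ⟨q, hqd', fun x _ => ?_, ?_⟩
  · -- the integrand of `q` is `F_m`, verbatim
    rw [hqi, hAi, hP1i, hP2i, hP3i, hP4i]
    simp only [Pi.add_apply, Pi.sub_apply, Equiv.swap_apply_left, Equiv.swap_apply_right,
      ellIntegrand]
    ring
  · -- rule (1b) twice around the swap (rule 2)
    have R1 : of r - of A - of P4 ∈ relations := by
      refine integrandAddRel_subset_relations
        ⟨2, r, A, P4, hAd'.trans hrd.symm, hP4d.trans hrd.symm, fun x hx => ?_, rfl⟩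
      rw [hrd] at hx
      rw [hri hx, Pi.add_apply, hAi, hP4i, hP2i, hP3i]
      simp only [Pi.sub_apply, ellIntegrand]
      ring
    have R2 : of q - of A - of P1 ∈ relations :=
      integrandAddRel_subset_relations
        ⟨2, q, A, P1, hAd'.trans hqd'.symm, hP1d.trans hqd'.symm, fun x _ => congrFun hqi x, rfl⟩
    have : of r - of q = (of r - of A - of P4) - (of q - of A - of P1) + (of P4 - of P1) := by
      abel
    show of r - of q ∈ relations
    rw [this]
    exact relations.add_mem (relations.sub_mem R1 R2) R3

end Summit.KontsevichZagierPeriods.UnfoldedStokes.LegendreAllModuliLine
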